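import Summits.ABC.ABC.Theorems.TwistAmplificationSharpModerateLawFewDeepSlices
import Literature.NumberTheory.Sieve.DivisorBound

/-!
# Crux `TwistAmplification.SharpModerateLaw` (stmt-ABC-1975), line `syzygy-lattice-half-deep-few-primes`:
the stub `stub_fewDeepOfLattice : FewDeepOfLattice` (`LatticeHalf → FieldSum → FewDeepLaw`)

Assembly of the few-deep-primes law (additive constant `0`) from Kane's lattice half and the field sum,
on `TwistAmplificationSharpModerateLawFewDeep{Budget,Slices}.lean`. For a maximal form `F` of
discriminant `D`, `0 < |D| ≤ ⌈2Y⌉`, the few-deep part of `ifShell F X Y` is finite (`finite_mplus_le`) and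
is sliced by the key `(g, t) = (gcd q, forced divisor of q)`, `t ∣ g ≤ ⌈2Y⌉`; on a slice, `q ↦ q/g` is
injective into the primitive set counted by `LatticeHalf` with parameters
`(t, Y/g⁶, 6·a·t·X/ρ², X·Y^{-1/6}/(g·rad D))` (`prim_mem_lhSet`), all `≥ 1` as soon as the slice is
nonempty (`depthRad ≥ 1` forces the depth cap to be `≥ 1` — the source of the additive constant `0`).
`LatticeHalf` and `key_bound` bound a slice by `≪ (XY)^{O(δ)} · X Y^{-1/6} · gcd(g, rad D)/(g · rad D)`;
there are `≤ τ(g) ≤ C_τ ⌈2Y⌉^δ` keys per `g` (tree divisor bound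
`Literature.NumberTheory.Sieve.exists_card_divisors_le_mul_rpow`) and
`Σ_g gcd(g, rad D)/g ≤ τ(rad D) · H_{⌈2Y⌉}` (`sum_gcd_div_le`), whence
`shellCount FewDeep X Y F ≤ K · X^δ Y^{8δ} · X Y^{-1/6}/rad D` (`shellCount_fewDeep_le`). Summing over
the `hmax D` maximal orbits (`orbitTotal_le`; non-maximal representatives count `0`) and over `D` with
`FieldSum` at `N = ⌈2Y⌉` gives `FewDeepLaw` (take `δ = ε/9`).
-/

noncomputable section

namespace Summit.ABC.ABC.Theorems.SharpModerateLaw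

namespace FewDeepSlice

open Literature.NumberTheory.CubicFields
open UniqueFactorizationMonoid (radical radical_dvd_self radical_dvd_radical)
open scoped BigOperators

/-! ## 5. The count for one maximal form -/

/-- **Per-form bound.** For `F` maximal with `0 < |D| ≤ 3Y` and `X, Y ≥ 1`:
`shellCount FewDeep X Y F ≤ K · X^δ Y^{8δ} · X Y^{-1/6} / rad|D|` (slices by the key `(g, t)`,
Kane's bound per key, `#t ≤ τ(g) ≤ C_τ N^δ`, `Σ_g gcd(g, rad D)/g ≤ τ(rad D) H_N`). -/
theorem shellCount_fewDeep_le (hL : LatticeHalf) {δ : ℝ} (hδ : 0 < δ) :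
    ∃ K : ℝ, 0 ≤ K ∧ ∀ F : BinaryCubic ℤ, RingOfForm.IsMaximal F → F.disc ≠ 0 →
      ∀ X Y : ℝ, 1 ≤ X → 1 ≤ Y → (F.disc.natAbs : ℝ) ≤ 3 * Y →
        (shellCount FewDeep X Y F : ℝ) ≤
          K * (X ^ δ * Y ^ (8 * δ)) * (X * Y ^ (-(1 / 6 : ℝ))) / radical F.disc.natAbs := by
  obtain ⟨C₁, hC₁⟩ := hL δ hδ
  obtain ⟨Cτ, hCτ1, hCτ⟩ := Literature.NumberTheory.Sieve.exists_card_divisors_le_mul_rpow hδ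
  set C := max C₁ 0 with hC_def
  have hC0 : 0 ≤ C := le_max_right _ _
  have hCτ0 : 0 ≤ Cτ := by linarith
  refine ⟨C * 486 ^ δ * 279937 * (Cτ * 3 ^ δ) ^ 2 * ((1 + 1 / δ) * 3 ^ δ), by positivity, ?_⟩
  intro F hmax hD X Y hX hY hDY
  classical
  set Dn := F.disc.natAbs with hDn
  set R := radical Dn with hR_def
  set N := ⌈2 * Y⌉₊ with hN_def
  have hY0 : 0 < Y := by linarith
  have hDn0 : Dn ≠ 0 := Int.natAbs_ne_zero.mpr hD
  have hR0 : R ≠ 0 := (Nat.radical_pos Dn).ne'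
  have hR1 : 1 ≤ R := Nat.radical_pos Dn
  have hN3 : (N : ℝ) ≤ 3 * Y := (Nat.ceil_lt_add_one (by positivity)).le.trans (by linarith)
  have hN1 : 1 ≤ N := Nat.one_le_iff_ne_zero.mpr (Nat.pos_iff_ne_zero.mp (Nat.ceil_pos.mpr (by linarith)))
  have hRY : (R : ℝ) ≤ 3 * Y := le_trans (by exact_mod_cast Nat.radical_le_self_iff.mpr hDn0) hDY
  -- the counted set is finite
  set S : Set (ℤ × ℤ) := {q | RingOfForm.IsMaximal F ∧ q ∈ ifShell F X Y ∧ FewDeep X Y F q} with hS_def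
  have hSfin : S.Finite := (finite_mplus_le hD N).subset fun q hq => by
    have h : (Mplus F q : ℝ) < 2 * Y := hq.2.1.2.2.2.2.2.1
    exact_mod_cast (h.le.trans (Nat.le_ceil _) : (Mplus F q : ℝ) ≤ N)
  have hcount : shellCount FewDeep X Y F = hSfin.toFinset.card := Set.ncard_eq_toFinset_card S hSfin
  -- primitive part, forced divisor and the key `(g, t)` of a point; the key range
  set pr : ℤ × ℤ → ℤ × ℤ := fun q => (q.1 / (Int.gcd q.1 q.2 : ℤ), q.2 / (Int.gcd q.1 q.2 : ℤ)) with hpr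
  set tf : ℤ × ℤ → ℕ := fun q => ∏ p ∈ (Int.gcd q.1 q.2).primeFactors with
    (5 ≤ p ∧ ¬ p ∣ F.disc.natAbs) ∧ p ∣ (F.eval (pr q).1 (pr q).2).natAbs, p with htf
  set key : ℤ × ℤ → ℕ × ℕ := fun q => (Int.gcd q.1 q.2, tf q) with hkey_def
  set KS : Finset (ℕ × ℕ) := (Finset.Icc 1 N ×ˢ Finset.Icc 1 N).filter (fun k => k.2 ∣ k.1)
    with hKS
  have hmaps : Set.MapsTo key ↑hSfin.toFinset ↑KS := fun q hq => by
    rw [Set.Finite.coe_toFinset] at hq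
    obtain ⟨hg1, hgN, htg, -⟩ := key_facts hD hq.2.1 (t := tf q) rfl rfl rfl
    have ht1 : 1 ≤ tf q := prod_primeFactors_filter_pos
    simp only [hKS, Finset.coe_filter, Finset.mem_product, Finset.mem_Icc, Set.mem_setOf_eq, hkey_def]
    exact ⟨⟨⟨hg1, hgN⟩, ht1, (Nat.le_of_dvd hg1 htg).trans hgN⟩, htg⟩
  set Q : ℝ := X * Y ^ (-(1 / 6 : ℝ)) with hQ
  set E : ℝ := C * (486 * X * Y ^ 5) ^ δ * (279937 * Q) with hE
  -- the bound per key
  have hkey : ∀ k ∈ KS, ((hSfin.toFinset.filter (fun q => key q = k)).card : ℝ) ≤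
      E * (Nat.gcd k.1 R) / (k.1 * R) := by
    intro k hk
    obtain ⟨hk1, -⟩ := Finset.mem_filter.mp hk
    obtain ⟨hkg, hkt⟩ := Finset.mem_product.mp hk1
    obtain ⟨hg1, hgN⟩ := Finset.mem_Icc.mp hkg
    obtain ⟨ht1, -⟩ := Finset.mem_Icc.mp hkt
    set Sk := hSfin.toFinset.filter (fun q => key q = k) with hSk
    rcases Sk.eq_empty_or_nonempty with h0 | ⟨q₁, hq₁⟩
    · rw [h0, Finset.card_empty, Nat.cast_zero]; positivity
    have hgq : ∀ q ∈ Sk, Int.gcd q.1 q.2 = k.1 ∧ tf q = k.2 ∧ q ∈ ifShell F X Y ∧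
        FewDeep X Y F q := fun q hq => by
      obtain ⟨hqS, hqk⟩ := Finset.mem_filter.mp hq
      rw [Set.Finite.mem_toFinset] at hqS
      exact ⟨congrArg Prod.fst hqk, congrArg Prod.snd hqk, hqS.2.1, hqS.2.2⟩
    obtain ⟨hg₁, ht₁, hsh₁, hfd₁⟩ := hgq q₁ hq₁
    set g := k.1 with hg_def
    set t := k.2 with ht_def
    set Y' : ℝ := Y / (g : ℝ) ^ 6 with hY'
    set B : ℝ := 6 * ((∏ p ∈ g.primeFactors with 5 ≤ p ∧ p ∣ F.disc.natAbs, p : ℕ) : ℝ) * t * X /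
      ((∏ p ∈ g.primeFactors with 5 ≤ p, p : ℕ) : ℝ) ^ 2 with hB_def
    set w : ℝ := Q / (g * R) with hw_def
    set L : Set (ℤ × ℤ) := {x | Int.gcd x.1 x.2 = 1 ∧ Y' ≤ (Mplus F x : ℝ) ∧
      (Mplus F x : ℝ) < 2 * Y' ∧ F.eval x.1 x.2 ≠ 0 ∧ (t : ℤ) ∣ F.disc * F.eval x.1 x.2 ∧
      ((radical (F.disc * F.eval x.1 x.2).natAbs : ℕ) : ℝ) ≤ B ∧
      ((depthRad (F.eval x.1 x.2).natAbs : ℕ) : ℝ) ≤ w} with hL_def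
    have hmem : ∀ q ∈ Sk, pr q ∈ L := fun q hq => by
      obtain ⟨hg, ht, hsh, hfd⟩ := hgq q hq
      have h := (prim_mem_lhSet hD hsh hfd (q₀ := pr q) (t := tf q) rfl rfl rfl rfl).1
      rw [hg, ht] at h
      exact h
    obtain ⟨-, h256⟩ := prim_mem_lhSet hD hsh₁ hfd₁ (q₀ := pr q₁) (t := tf q₁) rfl rfl rfl rfl
    have hm₁ := hmem q₁ hq₁
    have hY'1 : 1 ≤ Y' := by
      have h1 : (256 : ℝ) ≤ Mplus F (pr q₁) := by exact_mod_cast h256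
      linarith [hm₁.2.2.1]
    have hB1 : 1 ≤ B := le_trans (by exact_mod_cast Nat.radical_pos _) hm₁.2.2.2.2.2.1
    have hw1 : 1 ≤ w := le_trans (by exact_mod_cast Nat.radical_pos _) hm₁.2.2.2.2.2.2
    have hinj : Set.InjOn pr ↑Sk := fun q hq q' hq' h => by
      have hg := (hgq q hq).1
      have hg' := (hgq q' hq').1
      have h1 : q.1 / (g : ℤ) = q'.1 / (g : ℤ) := by
        have := congrArg Prod.fst h; simp only [hpr] at this; rwa [hg, hg'] at this
      have h2 : q.2 / (g : ℤ) = q'.2 / (g : ℤ) := by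
        have := congrArg Prod.snd h; simp only [hpr] at this; rwa [hg, hg'] at this
      have e := smul_ediv_gcd q
      have e' := smul_ediv_gcd q'
      rw [hg] at e
      rw [hg'] at e'
      rw [← e, ← e', h1, h2]
    have hfinL : L.Finite := (finite_mplus_le hD ⌈2 * Y'⌉₊).subset fun x hx => by
      have h : (Mplus F x : ℝ) < 2 * Y' := hx.2.2.1
      exact_mod_cast (h.le.trans (Nat.le_ceil _) : (Mplus F x : ℝ) ≤ ⌈2 * Y'⌉₊)
    have hsub : ↑(Sk.image pr) ⊆ L := fun x hx => by
      obtain ⟨q, hq, rfl⟩ := Finset.mem_image.mp (Finset.mem_coe.mp hx)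
      exact hmem q hq
    obtain ⟨-, -, htg, hgρ, haG, hRt⟩ := key_facts hD hsh₁ (t := tf q₁) rfl rfl rfl
    rw [hg₁] at htg hgρ haG
    rw [ht₁] at htg hRt
    have hRt' : R * t ≤ radical (F.disc * (t : ℤ)).natAbs := by
      rw [Int.natAbs_mul, Int.natAbs_natCast]
      exact Nat.le_of_dvd (Nat.radical_pos _) hRt
    have hGpos : 0 < Nat.gcd g R := Nat.gcd_pos_of_pos_left _ hg1
    calc (Sk.card : ℝ) = ((Sk.image pr).card : ℝ) := by rw [Finset.card_image_of_injOn hinj]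
      _ = ((↑(Sk.image pr) : Set (ℤ × ℤ)).ncard : ℝ) := by rw [Set.ncard_coe_finset]
      _ ≤ L.ncard := by exact_mod_cast Set.ncard_le_ncard hsub hfinL
      _ ≤ C * ((Dn : ℝ) * Y' * B * t) ^ δ *
            (B * Y' ^ (-(1 / 6 : ℝ)) / ((radical (F.disc * (t : ℤ)).natAbs : ℕ) : ℝ) + w) := by
          refine (hC₁ F hmax hD t ht1 Y' B w hY'1 hB1 hw1).trans ?_
          have hA : 0 ≤ ((Dn : ℝ) * Y' * B * t) ^ δ := Real.rpow_nonneg (by positivity) _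
          have hT : 0 ≤ B * Y' ^ (-(1 / 6 : ℝ)) / ((radical (F.disc * (t : ℤ)).natAbs : ℕ) : ℝ) + w := by
            positivity
          exact mul_le_mul_of_nonneg_right (mul_le_mul_of_nonneg_right (le_max_left _ _) hA) hT
      _ ≤ C * (486 * X * Y ^ 5) ^ δ * (279937 * Q * (Nat.gcd g R) / (g * R)) :=
          key_bound hX hY hδ.le hC0 hg1 hgN hN3 hDY ht1 (Nat.le_of_dvd hg1 htg)
            (Nat.le_of_dvd hg1 (prod_primeFactors_filter_dvd fun p hp _ => Nat.dvd_of_mem_primeFactors hp))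
            prod_primeFactors_filter_pos hgρ (Nat.le_of_dvd hGpos haG) hGpos hR1 hRt'
      _ = E * (Nat.gcd g R) / (g * R) := by rw [hE]; ring
  -- summing the keys
  have hfib : ∀ g ∈ Finset.Icc 1 N, ((KS.filter (fun k => k.1 = g)).card : ℝ) ≤ Cτ * (N : ℝ) ^ δ := by
    intro g hg
    obtain ⟨hg1, hgN⟩ := Finset.mem_Icc.mp hg
    have h1 : (KS.filter (fun k => k.1 = g)).card ≤ g.divisors.card := by
      refine Finset.card_le_card_of_injOn Prod.snd (fun k hk => ?_) fun k hk k' hk' h => ?_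
      · obtain ⟨hk, hkg⟩ := Finset.mem_filter.mp (Finset.mem_coe.mp hk)
        have hdv : k.2 ∣ k.1 := (Finset.mem_filter.mp hk).2
        rw [hkg] at hdv
        exact Finset.mem_coe.mpr (Nat.mem_divisors.mpr ⟨hdv, by omega⟩)
      · have e1 : k.1 = k'.1 := (Finset.mem_filter.mp (Finset.mem_coe.mp hk)).2.trans
          (Finset.mem_filter.mp (Finset.mem_coe.mp hk')).2.symm
        exact Prod.ext e1 h
    calc ((KS.filter (fun k => k.1 = g)).card : ℝ) ≤ g.divisors.card := by exact_mod_cast h1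
      _ ≤ Cτ * (g : ℝ) ^ δ := hCτ g (by omega)
      _ ≤ Cτ * (N : ℝ) ^ δ :=
          mul_le_mul_of_nonneg_left (Real.rpow_le_rpow (by positivity) (by exact_mod_cast hgN) hδ.le) hCτ0
  have hNδ : (N : ℝ) ^ δ ≤ 3 ^ δ * Y ^ δ := by
    rw [← Real.mul_rpow (by norm_num) hY0.le]; exact Real.rpow_le_rpow (by positivity) hN3 hδ.le
  have hRδ : (R : ℝ) ^ δ ≤ 3 ^ δ * Y ^ δ := by
    rw [← Real.mul_rpow (by norm_num) hY0.le]; exact Real.rpow_le_rpow (by positivity) hRY hδ.le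
  have h486 : (486 * X * Y ^ 5) ^ δ = 486 ^ δ * X ^ δ * Y ^ (5 * δ) := by
    rw [Real.mul_rpow (by positivity) (by positivity), Real.mul_rpow (by positivity) (by positivity),
      Real.rpow_mul hY0.le]
    norm_num [Real.rpow_natCast]
  have hY8 : Y ^ (8 * δ) = Y ^ δ * Y ^ δ * Y ^ δ * Y ^ (5 * δ) := by
    rw [← Real.rpow_add hY0, ← Real.rpow_add hY0, ← Real.rpow_add hY0]; ring_nf
  have hE0 : 0 ≤ E := by positivity
  rw [hcount, Finset.card_eq_sum_card_fiberwise hmaps]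
  push_cast
  calc ∑ k ∈ KS, ((hSfin.toFinset.filter (fun q => key q = k)).card : ℝ)
      ≤ ∑ k ∈ KS, E * (Nat.gcd k.1 R) / (k.1 * R) := Finset.sum_le_sum hkey
    _ = ∑ g ∈ Finset.Icc 1 N, ∑ k ∈ KS with k.1 = g, E * (Nat.gcd k.1 R) / (k.1 * R) :=
        (Finset.sum_fiberwise_of_maps_to (g := Prod.fst)
          (fun k hk => (Finset.mem_product.mp (Finset.mem_filter.mp hk).1).1) _).symm
    _ = ∑ g ∈ Finset.Icc 1 N, ((KS.filter (fun k => k.1 = g)).card : ℝ) *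
          (E * (Nat.gcd g R) / (g * R)) := by
        refine Finset.sum_congr rfl fun g _ => ?_
        rw [Finset.sum_congr rfl fun k hk => by rw [(Finset.mem_filter.mp hk).2], Finset.sum_const,
          nsmul_eq_mul]
    _ ≤ ∑ g ∈ Finset.Icc 1 N, (Cτ * (N : ℝ) ^ δ) * (E * (Nat.gcd g R) / (g * R)) :=
        Finset.sum_le_sum fun g hg => mul_le_mul_of_nonneg_right (hfib g hg) (by positivity)
    _ = (Cτ * (N : ℝ) ^ δ) * (E / R) * ∑ g ∈ Finset.Icc 1 N, ((Nat.gcd g R : ℕ) : ℝ) / g := by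
        rw [Finset.mul_sum]
        refine Finset.sum_congr rfl fun g hg => ?_
        have : (g : ℝ) ≠ 0 := by exact_mod_cast (Nat.pos_of_ne_zero (by
          have := (Finset.mem_Icc.mp hg).1; omega)).ne'
        field_simp
    _ ≤ (Cτ * (N : ℝ) ^ δ) * (E / R) * (R.divisors.card * ∑ b ∈ Finset.Icc 1 N, (1 : ℝ) / b) := by
        gcongr; exact sum_gcd_div_le hR0 N
    _ ≤ (Cτ * (N : ℝ) ^ δ) * (E / R) * ((Cτ * (R : ℝ) ^ δ) * ((1 + 1 / δ) * (N : ℝ) ^ δ)) := by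
        gcongr
        · exact hCτ R hR0
        · exact harmonic_le_rpow hδ hN1
    _ = (Cτ ^ 2 * (1 + 1 / δ) * C * 279937) *
          ((N : ℝ) ^ δ * (N : ℝ) ^ δ * (R : ℝ) ^ δ * (486 * X * Y ^ 5) ^ δ) * Q / R := by
        rw [hE]; ring
    _ ≤ (Cτ ^ 2 * (1 + 1 / δ) * C * 279937) *
          ((3 ^ δ * Y ^ δ) * (3 ^ δ * Y ^ δ) * (3 ^ δ * Y ^ δ) * (486 ^ δ * X ^ δ * Y ^ (5 * δ))) *
            Q / R := by
        rw [h486]; gcongr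
    _ = _ := by rw [hY8]; ring

/-! ## 6. Orbit and discriminant sums: the stub -/

/-- Orbit sum of a per-form bound: non-maximal representatives contribute `0`, the
`hmax D` maximal ones at most `M` each. -/
theorem orbitTotal_le {D : ℤ} (hD : D ≠ 0) {M : ℝ} (X Y : ℝ)
    (h : ∀ F : BinaryCubic ℤ, RingOfForm.IsMaximal F → F.disc = D →
      (shellCount FewDeep X Y F : ℝ) ≤ M) :
    (orbitTotal D (shellCount FewDeep X Y) : ℝ) ≤ hmax D * M := by
  classical
  haveI : Fintype (orbitsOfDisc D) := @Fintype.ofFinite _ (finite_orbitsOfDisc hD)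
  have hO : ∀ O : orbitsOfDisc D, (shellCount FewDeep X Y (orbitRep O) : ℝ) ≤
      if RingOfForm.IsMaximal (orbitRep O) then M else 0 := fun O => by
    split_ifs with hm
    · exact h _ hm (orbitRep_spec O).2
    · simp [shellCount, hm]
  simp only [orbitTotal, finsum_eq_sum_of_fintype, hmax, Nat.card_eq_fintype_card,
    Fintype.card_subtype]
  push_cast
  calc ∑ O : orbitsOfDisc D, (shellCount FewDeep X Y (orbitRep O) : ℝ)
      ≤ ∑ O : orbitsOfDisc D, (if RingOfForm.IsMaximal (orbitRep O) then M else 0) :=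
        Finset.sum_le_sum fun O _ => hO O
    _ = _ := by
        rw [Finset.sum_ite, Finset.sum_const_zero, add_zero, Finset.sum_const, nsmul_eq_mul]

end FewDeepSlice

open UniqueFactorizationMonoid (radical) in
open FewDeepSlice in
/-- **stub_fewDeepOfLattice**: the lattice half and the field sum give the few-deep-primes law
(additive constant `0`: the few-deep slice of the shell is empty unless its depth cap is `≥ 1`). -/
theorem stub_fewDeepOfLattice : FewDeepOfLattice := by
  intro hL hF ε hε
  have hδ : (0 : ℝ) < ε / 9 := by positivity
  obtain ⟨K, hK0, hK⟩ := shellCount_fewDeep_le hL hδ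
  obtain ⟨C₂, hC₂⟩ := hF (ε / 9) hδ
  refine ⟨K * max C₂ 0 * 3 ^ (ε / 9), fun X Y hX hY => ?_⟩
  have hY0 : 0 < Y := by linarith
  set δ := ε / 9 with hδ_def
  set N := ⌈2 * Y⌉₊ with hN
  have hN3 : (N : ℝ) ≤ 3 * Y := (Nat.ceil_lt_add_one (by positivity)).le.trans (by linarith)
  have hN1 : 1 ≤ N := Nat.one_le_iff_ne_zero.mpr (Nat.pos_iff_ne_zero.mp (Nat.ceil_pos.mpr (by linarith)))
  set Q : ℝ := X * Y ^ (-(1 / 6 : ℝ)) with hQ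
  set M : ℝ := K * (X ^ δ * Y ^ (8 * δ)) * Q with hM_def
  have hM0 : 0 ≤ M := by positivity
  have h1 : (totalCount FewDeep X Y : ℝ) ≤
      ∑ D ∈ (Finset.Icc (-(N : ℤ)) N).erase 0, (hmax D : ℝ) * (M / radical D.natAbs) := by
    unfold totalCount
    push_cast
    refine Finset.sum_le_sum fun D hD => ?_
    obtain ⟨hD0, hDI⟩ := Finset.mem_erase.mp hD
    refine orbitTotal_le hD0 X Y fun F hFmax hFD => ?_
    obtain ⟨hl, hr⟩ := Finset.mem_Icc.mp hDI
    have hDN : (D.natAbs : ℤ) ≤ N := by rw [Int.natCast_natAbs]; exact abs_le.mpr ⟨hl, hr⟩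
    have hDY : (F.disc.natAbs : ℝ) ≤ 3 * Y := by
      rw [hFD]; exact le_trans (by exact_mod_cast hDN) hN3
    have h := hK F hFmax (hFD ▸ hD0) X Y hX hY hDY
    rw [hFD] at h
    exact h
  have h2 : ∑ D ∈ (Finset.Icc (-(N : ℤ)) N).erase 0, (hmax D : ℝ) * (M / radical D.natAbs) =
      M * ∑ D ∈ (Finset.Icc (-(N : ℤ)) N).erase 0, (hmax D : ℝ) / radical D.natAbs := by
    rw [Finset.mul_sum]
    exact Finset.sum_congr rfl fun D _ => by ring
  have hNδ : (N : ℝ) ^ δ ≤ 3 ^ δ * Y ^ δ := by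
    rw [← Real.mul_rpow (by norm_num) hY0.le]; exact Real.rpow_le_rpow (by positivity) hN3 hδ.le
  have hXY : X ^ δ * Y ^ (8 * δ) * Y ^ δ ≤ (X * Y) ^ ε := by
    rw [Real.mul_rpow (by positivity) hY0.le, mul_assoc, ← Real.rpow_add hY0,
      show 8 * δ + δ = ε by rw [hδ_def]; ring]
    exact mul_le_mul_of_nonneg_right (Real.rpow_le_rpow_of_exponent_le hX (by linarith))
      (by positivity)
  calc (totalCount FewDeep X Y : ℝ)
      ≤ M * ∑ D ∈ (Finset.Icc (-(N : ℤ)) N).erase 0, (hmax D : ℝ) / radical D.natAbs := h1.trans h2.le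
    _ ≤ M * (max C₂ 0 * (N : ℝ) ^ δ) := by
        gcongr
        exact (hC₂ N hN1).trans (mul_le_mul_of_nonneg_right (le_max_left _ _) (by positivity))
    _ ≤ M * (max C₂ 0 * (3 ^ δ * Y ^ δ)) := by gcongr
    _ = K * max C₂ 0 * 3 ^ δ * (X ^ δ * Y ^ (8 * δ) * Y ^ δ) * Q := by rw [hM_def]; ring
    _ ≤ K * max C₂ 0 * 3 ^ δ * (X * Y) ^ ε * Q := by gcongr
    _ = K * max C₂ 0 * 3 ^ (ε / 9) * (X * Y) ^ ε * (X * Y ^ (-(1 / 6 : ℝ)) + 0) := by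
        rw [add_zero]

end Summit.ABC.ABC.Theorems.SharpModerateLaw

end
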